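import Summits.Ventures.YMGap.FlowData.RectTubeTransferBilinearReduction
import Summits.Ventures.YMGap.FlowData.SU2WeightCharacterSeries
import HarnessLib

/-!
# Venture YMGap, track Y3 FLOW-DATA — THE STRONG-COUPLING WINDOW OF THE VACUUM ENERGY on rectangular `SU(2)` tubes:
# `|ln λ̂₀(β) − N_ℓ · ln((I₀−I₂)(β))| ≤ β · #plaquettes` (`λ̂₀ = ‖T‖`; FLOW-PLAN O0; theorems only)

HONEST FRAMING: venture file of the cell `pub-ymgap` (QuantumFields programme), track Y3; companion THEOREMS for
`FlowData/RectTubeTransferOperator.lean`.  The FLOW-TABLE's O0 row is `f̂ = −ln λ̂₀/|Λ|` with `λ̂₀ = ‖T̂‖`; the cell's `T`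
(`rectTubeTransferOperator (fundamentalRep (Fin 2)) (β/2) Ls`: plaquette weight `e^{β·½Tr U_p}` split symmetrically between
the two slices, temporal links Haar-averaged) has `λ̂₀ = ‖T‖` within `β·#P` of its strong-coupling value `c₀(β)^{N_ℓ}`,
`c₀(β) = ∫ e^{β a₀} = I₀(β) − I₂(β) = 2I₁(β)/β`, `N_ℓ = #links`, `#P = #sites · k(k−1)/2`.  Finite tubes only; no number of
the table, no row, nothing about `L → ∞`, the continuum or a mass gap.  Both halves are in the tree's norm bounds
(`RectTubeTorelonEnvelope.norm_rectTubeTransferOperator_le`, `RectTubeTransferBilinearReduction.norm_rectTubeTransferOperator_ge`);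
this file only puts them in the table's vocabulary.  DICTIONARY (flow-theory, 2026-08-24T14:29Z): the table's `λ̂₀` is the
top eigenvalue of the NORMALISED `T̂ = K̂^½ P̂ K̂^½` of FLOW-PLAN §1.2 (temporal kernel divided by `2I₁(β)/β` per link, plaquette
weight `e^{β(½Tr U_p − 1)} ≤ 1`), so `ln ‖T‖ = ln λ̂₀ + N_ℓ·ln(2I₁(β)/β) + β·N_sp` and the theorem below reads on the table as
`−2β·N_sp ≤ ln λ̂₀ ≤ 0` (the content is the lower edge; `N_sp = #sites·k(k−1)/2`).

* **`abs_log_norm_su2RectTubeTransferOperator_sub_le`** — `|log ‖T_β‖ − N_ℓ · log((I₀−I₂)(β)/1)| ≤ β · (#sites · k(k−1)/2)`,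
  every `β > 0`; `tendsto_log_norm_su2RectTubeTransferOperator_sub_nhdsWithin_zero` — the difference `→ 0` as `β → 0⁺`.

References: I. Montvay, G. Münster (1994) §3.2.6 [cite: MontvayMunster1994, §3.2.6]; K. Osterwalder, E. Seiler, Ann. Phys.
110 (1978) 440 §3 [cite: OsterwalderSeilerAnnPhys1978, §3].
-/

noncomputable section

open scoped BigOperators Topology
open MeasureTheory Filter Function Polynomial.Chebyshev
open Literature.MathematicalPhysics.QuantumFieldTheory Literature.Analysis.OperatorTheory Literature.Analysis.FunctionSpaces
open Literature.MathematicalPhysics.QuantumLattice (RectTorusSite fundamentalRep continuous_fundamentalRep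
  fundamentalRep_mem_unitaryGroup)
open Summit.Ventures.LatticeQCDFlow.Exactness Summit.Ventures.LatticeQCDFlow.Scoring

namespace Summit.Ventures.YMGap.FlowData

section SU2

variable {k : ℕ}

/-- **THE STRONG-COUPLING WINDOW OF THE VACUUM ENERGY.**  On every rectangular `SU(2)` tube `Π_i ℤ/(Ls i)` and every
`β > 0`: `|log ‖T_β‖ − N_ℓ · log((I₀(β) − I₂(β))/1)| ≤ β · (#sites · k(k−1)/2)` (`N_ℓ = #links`; `(I₀−I₂)(β) = 2I₁(β)/β` is the
one-link mass `∫ e^{β a₀}`). [cite: MontvayMunster1994, §3.2.6] -/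
theorem abs_log_norm_su2RectTubeTransferOperator_sub_le {β : ℝ} (hβ : 0 < β) (Ls : Fin k → ℕ) [∀ i, NeZero (Ls i)] :
    |Real.log ‖rectTubeTransferOperator (fundamentalRep (Fin 2)) (β / 2) Ls‖ -
        (Fintype.card (RectTorusSite Ls × Fin k) : ℝ) * Real.log ((besselI 0 β - besselI (0 + 2) β) / ((0 : ℕ) + 1))| ≤
      β * (Fintype.card (RectTorusSite Ls) * Fintype.card {p : Fin k × Fin k // p.1 < p.2}) := by
  haveI : SecondCountableTopology (Matrix.specialUnitaryGroup (Fin 2) ℂ) := secondCountableTopology_su2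
  set P : ℝ := (Fintype.card (RectTorusSite Ls) : ℝ) * (Fintype.card {p : Fin k × Fin k // p.1 < p.2} : ℝ) with hP
  set N : ℕ := Fintype.card (RectTorusSite Ls × Fin k) with hN
  set c0 : ℝ := (besselI 0 β - besselI (0 + 2) β) / ((0 : ℕ) + 1) with hc0
  -- `∫ e^{(β/2) Re tr U} dU = c₀(β) = (I₀−I₂)(β)/1`
  have hc0' : (∫ g : Matrix.specialUnitaryGroup (Fin 2) ℂ, Real.exp (β / 2 * ((fundamentalRep (Fin 2) g).trace).re)
      ∂haarProbability (Matrix.specialUnitaryGroup (Fin 2) ℂ)) = c0 := by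
    have h := integral_weight_mul_su2Character hβ.le 0 1 1
    simp only [one_mul, mul_one, su2a0_inv, Nat.cast_zero, U_zero, Polynomial.eval_one] at h
    rw [hc0, Nat.cast_zero, ← h]
    exact integral_congr_ae (Eventually.of_forall fun U => by simp only [su2_weight_eq]; ring_nf)
  have hc0pos : 0 < c0 := by
    rw [← hc0']
    exact integral_exp_pos ((Real.continuous_exp.comp (continuous_const.mul (Complex.continuous_re.comp
      (continuous_fundamentalRep (Fin 2)).matrix_trace))).integrable_of_hasCompactSupport (HasCompactSupport.of_compactSpace _))
  have hJ : |β / 2| * ((2 : ℕ) * ((Fintype.card (RectTorusSite Ls) : ℝ) *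
      (Fintype.card {p : Fin k × Fin k // p.1 < p.2} : ℝ))) = β * P := by
    rw [abs_of_pos (half_pos hβ)]; push_cast; ring
  have hTle : ‖rectTubeTransferOperator (fundamentalRep (Fin 2)) (β / 2) Ls‖ ≤ Real.exp (β * P) * c0 ^ N := by
    have h := norm_rectTubeTransferOperator_le (fundamentalRep (Fin 2)) (β / 2) (Ls := Ls)
      (continuous_fundamentalRep (Fin 2)) fundamentalRep_mem_unitaryGroup
    rwa [hc0', hJ] at h
  have hTge : Real.exp (-(β * P)) * c0 ^ N ≤ ‖rectTubeTransferOperator (fundamentalRep (Fin 2)) (β / 2) Ls‖ := by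
    have h := norm_rectTubeTransferOperator_ge (fundamentalRep (Fin 2)) (β / 2) (Ls := Ls)
      (continuous_fundamentalRep (Fin 2)) fundamentalRep_mem_unitaryGroup two_ne_zero (su2_integral_exp_mul_apply (β / 2))
    rwa [hc0', hJ] at h
  have hTpos : 0 < ‖rectTubeTransferOperator (fundamentalRep (Fin 2)) (β / 2) Ls‖ :=
    lt_of_lt_of_le (mul_pos (Real.exp_pos _) (pow_pos hc0pos _)) hTge
  have h1 : Real.log ‖rectTubeTransferOperator (fundamentalRep (Fin 2)) (β / 2) Ls‖ ≤ β * P + (N : ℝ) * Real.log c0 := by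
    have h := Real.log_le_log hTpos hTle
    rwa [Real.log_mul (Real.exp_pos _).ne' (pow_pos hc0pos _).ne', Real.log_exp, Real.log_pow] at h
  have h2 : -(β * P) + (N : ℝ) * Real.log c0 ≤ Real.log ‖rectTubeTransferOperator (fundamentalRep (Fin 2)) (β / 2) Ls‖ := by
    have h := Real.log_le_log (mul_pos (Real.exp_pos _) (pow_pos hc0pos _)) hTge
    rwa [Real.log_mul (Real.exp_pos _).ne' (pow_pos hc0pos _).ne', Real.log_exp, Real.log_pow] at h
  rw [abs_sub_le_iff]
  constructor <;> linarith

/-- **The vacuum energy has its strong-coupling asymptote**: `log ‖T_β‖ − N_ℓ·log((I₀−I₂)(β)/1) → 0` as `β → 0⁺` on every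
rectangular tube. [cite: MontvayMunster1994, §3.2.6] -/
theorem tendsto_log_norm_su2RectTubeTransferOperator_sub_nhdsWithin_zero (Ls : Fin k → ℕ) [∀ i, NeZero (Ls i)] :
    Tendsto (fun β : ℝ => Real.log ‖rectTubeTransferOperator (fundamentalRep (Fin 2)) (β / 2) Ls‖ -
        (Fintype.card (RectTorusSite Ls × Fin k) : ℝ) * Real.log ((besselI 0 β - besselI (0 + 2) β) / ((0 : ℕ) + 1)))
      (𝓝[>] (0 : ℝ)) (𝓝 0) := by
  have hb : Tendsto (fun β : ℝ => β * (Fintype.card (RectTorusSite Ls) * Fintype.card {p : Fin k × Fin k // p.1 < p.2}))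
      (𝓝[>] (0 : ℝ)) (𝓝 0) := by
    have h : Tendsto (fun β : ℝ => β * (Fintype.card (RectTorusSite Ls) * Fintype.card {p : Fin k × Fin k // p.1 < p.2}))
        (𝓝 (0 : ℝ)) (𝓝 (0 * (Fintype.card (RectTorusSite Ls) * Fintype.card {p : Fin k × Fin k // p.1 < p.2}))) :=
      (continuous_id.mul continuous_const).tendsto 0
    rw [zero_mul] at h
    exact h.mono_left nhdsWithin_le_nhds
  refine squeeze_zero_norm' ?_ hb
  filter_upwards [self_mem_nhdsWithin] with β hβ
  rw [Real.norm_eq_abs]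
  exact abs_log_norm_su2RectTubeTransferOperator_sub_le hβ Ls

end SU2

end Summit.Ventures.YMGap.FlowData
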